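import Literature.MathematicalPhysics.QuantumLattice.HubbardWave0RayleighProofs
import Literature.MathematicalPhysics.QuantumLattice.HyperoctahedralFockAction
import HarnessLib

/-!
# The second-quantisation functor `Γ(g)` on the fermionic Fock space

Topic `Literature/MathematicalPhysics/QuantumLattice`. On the tree's finite Jordan–Wigner Fock
space `Fock ι = Finset ι → ℂ` (occupation basis `|S⟩`, `creation i = c†_i`, `dGamma A = Σ Aᵢⱼ c†ᵢcⱼ`)
we introduce, for an ARBITRARY one-body matrix `g : Matrix ι ι ℂ` (not necessarily unitary,
Hermitian or invertible), its second quantisation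

  `Gamma g : Matrix (Finset ι) (Finset ι) ℂ`,  `⟨S| Γ(g) |T⟩ = det g[S,T]`  (`|S| = |T|`, else `0`),

the minor of `g` with rows `S` and columns `T` in increasing order — i.e. `Γ(g) = ⊕ₖ Λᵏ g`, the
direct sum of the compound matrices of `g`, the restriction to the antisymmetric Fock space of
`⊕ₖ g^{⊗k}` (Dereziński–Gérard, Def. 3.34, §3.3.3 "`Γ(p)` … the second quantization of `p`";
Bratteli–Robinson II §5.2.1). Everything is PROVED; the one definition is `Gamma`.

* `Gamma_apply_eq_sum_erase` — Laplace expansion of the minor along its first column, in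
  Jordan–Wigner form: `⟨S|Γ(g)|T⟩ = Σ_{x∈S} σ_x(S) g_{x t₀} ⟨S∖x|Γ(g)|T∖t₀⟩`, `t₀ = min T`;
* `col_Gamma_eq_create_mulVec` — hence the columns are Slater states built by smeared creation
  operators: `Γ(g)|T⟩ = c†(g e_{t₀}) Γ(g)|T∖t₀⟩`, so `Γ(g)|t₁<⋯<t_k⟩ = c†(ge_{t₁})⋯c†(ge_{t_k})|∅⟩`;
* `Gamma_mulVec_vacuum` (`Γ(g)|∅⟩ = |∅⟩`), `Gamma_mul_creation` / `Gamma_mul_create` — the defining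
  intertwining relation **`Γ(g) c†(f) = c†(g f) Γ(g)`** (Bratteli–Robinson II §5.2.1 with `U ↦ g`);
* **functoriality** `Gamma_one : Γ(1) = 1`, `Gamma_mul : Γ(gh) = Γ(g)Γ(h)`
  (Dereziński–Gérard Prop. 3.23 (1) `Γ(p₂)Γ(p₁) = Γ(p₂p₁)`), `Gamma_conjTranspose`,
  `Gamma_mem_unitaryGroup` (`Γ` of a unitary is unitary), `Gamma_inv_mul` / `Gamma_mul_inv`.

The companion file `FermionGammaFunctorTrace` proves `e^{dΓ(A)} = Γ(e^{A})`, `Tr Γ(g) = det(1+g)`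
and the product trace formula `Tr ∏_τ e^{dΓ(A_τ)} = det(1 + ∏_τ e^{A_τ})` for non-commuting `A_τ`.

## Mathlib / tree search

Mathlib has `ExteriorAlgebra.map` / `Module.Basis.exteriorPower` (abstract `Λ(g)`, coordinates
`exteriorPower.ιMultiDual_apply_ιMulti` as determinants) but no link to the tree's concrete
Jordan–Wigner matrices; we work directly with minors: `Matrix.det_succ_column_zero` (Laplace),
`Finset.orderEmbOfFin` / `orderEmbOfFin_unique` / `orderEmbOfFin_zero` (increasing enumeration),
`Matrix.det_submatrix_equiv_self`. Tree (REUSED): `creation`, `annihilation`, `jwSign`, `vacuum`,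
`RayleighBound.create` (`c†(f) = Σ fᵢ c†ᵢ`), `create_mul_create`, `create_mulVec_apply`,
`FermionOperatorsProofs.creation_mulVec_single`, `ext_of_mulVec_single`, `jwSign_erase_of_lt`,
`jwSign_mul_self`, and the cyclicity-of-the-vacuum lemma `eq_one_of_commute_creation_of_mulVec_vacuum`
(`HyperoctahedralFockAction`: an operator commuting with all `c†_i` and fixing `|∅⟩` is `1`).

## References

* J. Dereziński, C. Gérard, *Mathematics of Quantization and Quantum Fields*, CUP (2013; 2nd ed.
  2022), §3.2.2 Prop. 3.23 (1) (`Γ(p₂)Γ(p₁) = Γ(p₂p₁)`), §3.3.3 Def. 3.34 (`Γ(p)`, "the second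
  quantization of `p`"). [DerezinskiGerard2022]
* O. Bratteli, D. W. Robinson, *Operator Algebras and Quantum Statistical Mechanics 2*, 2nd ed.
  (Springer 1997), §5.2.1 (second quantisation `Γ(U)`, `Γ(U) a*(f) Γ(U)* = a*(Uf)`).
  [BratteliRobinsonII1997]
-/

noncomputable section

namespace Literature.MathematicalPhysics.QuantumLattice

open Matrix Finset RayleighBound

variable {ι : Type*} [LinearOrder ι] [Fintype ι]

/-! ### The definition and its matrix entries -/

/-- **The second quantisation `Γ(g)` of a one-body matrix `g`** on the Jordan–Wigner Fock space:
the operator whose matrix entry `⟨S| Γ(g) |T⟩` is the minor `det g[S,T]` of `g` with rows `S` and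
columns `T` enumerated increasingly (and `0` unless `|S| = |T|`); equivalently `⊕ₖ Λᵏ g`.
Dereziński–Gérard §3.3.3, Def. 3.34; Bratteli–Robinson II §5.2.1.
[cite: DerezinskiGerard2022, §3.3.3 Def. 3.34] -/
def Gamma (g : Matrix ι ι ℂ) : Matrix (Finset ι) (Finset ι) ℂ :=
  Matrix.of fun S T =>
    if h : S.card = T.card then (g.submatrix (S.orderEmbOfFin h) (T.orderEmbOfFin rfl)).det else 0

omit [Fintype ι] in
/-- The entry of `Γ(g)` at sets of equal size `k` is the `k × k` minor. [folklore] -/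
theorem Gamma_apply_of_card_eq (g : Matrix ι ι ℂ) {S T : Finset ι} {k : ℕ} (hS : S.card = k)
    (hT : T.card = k) :
    Gamma g S T = (g.submatrix (S.orderEmbOfFin hS) (T.orderEmbOfFin hT)).det := by
  subst hT
  simp only [Gamma, Matrix.of_apply, dif_pos hS]

omit [Fintype ι] in
/-- `Γ(g)` preserves the particle number: `⟨S|Γ(g)|T⟩ = 0` if `|S| ≠ |T|`. [folklore] -/
theorem Gamma_apply_of_card_ne (g : Matrix ι ι ℂ) {S T : Finset ι} (h : S.card ≠ T.card) :
    Gamma g S T = 0 := by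
  simp only [Gamma, Matrix.of_apply, dif_neg h]

omit [Fintype ι] in
/-- The vacuum column of `Γ(g)`: `⟨S|Γ(g)|∅⟩ = δ_{S,∅}` (the `0 × 0` minor is `1`). [folklore] -/
theorem Gamma_apply_empty_right (g : Matrix ι ι ℂ) (S : Finset ι) :
    Gamma g S ∅ = if S = ∅ then 1 else 0 := by
  by_cases hS : S = ∅
  · subst hS
    rw [Gamma_apply_of_card_eq g (k := 0) (card_empty) (card_empty), if_pos rfl]
    exact Matrix.det_isEmpty
  · rw [if_neg hS, Gamma_apply_of_card_ne]
    rwa [card_empty, Ne, card_eq_zero]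

omit [Fintype ι] in
/-- The vacuum column as a vector: `Γ(g)|∅⟩ = |∅⟩`. [folklore] -/
theorem col_Gamma_empty (g : Matrix ι ι ℂ) : (Gamma g).col ∅ = vacuum := by
  funext S
  rw [col_apply, Gamma_apply_empty_right, vacuum, Pi.single_apply]

/-- **`Γ(g)` fixes the vacuum**: `Γ(g)|∅⟩ = |∅⟩`. Dereziński–Gérard §3.3.3. [folklore] -/
theorem Gamma_mulVec_vacuum (g : Matrix ι ι ℂ) : Gamma g *ᵥ vacuum = vacuum := by
  rw [vacuum, mulVec_single_one, ← vacuum, col_Gamma_empty]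

/-! ### Increasing enumerations: three bookkeeping lemmas -/

omit [Fintype ι] in
/-- Exactly `i` elements of `S` lie below the `i`-th element of `S` (increasing enumeration), so
the Jordan–Wigner sign there is `(-1)^i`. [folklore] -/
theorem card_filter_lt_orderEmbOfFin (S : Finset ι) {k : ℕ} (h : S.card = k) (i : Fin k) :
    (S.filter (· < S.orderEmbOfFin h i)).card = i := by
  have hset : S.filter (· < S.orderEmbOfFin h i) =
      (Finset.univ.filter (· < i)).image (S.orderEmbOfFin h) := by
    ext x
    simp only [mem_filter, mem_image, mem_univ, true_and]
    constructor
    · rintro ⟨hx, hlt⟩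
      have hx' : x ∈ Set.range (S.orderEmbOfFin h) := by rw [range_orderEmbOfFin]; exact hx
      obtain ⟨j, rfl⟩ := hx'
      exact ⟨j, (S.orderEmbOfFin h).lt_iff_lt.mp hlt, rfl⟩
    · rintro ⟨j, hj, rfl⟩
      exact ⟨orderEmbOfFin_mem _ _ _, (S.orderEmbOfFin h).lt_iff_lt.mpr hj⟩
  rw [hset, card_image_of_injective _ (S.orderEmbOfFin h).injective]
  have : (Finset.univ.filter (· < i)) = Finset.Iio i := by ext; simp
  rw [this, Fin.card_Iio]

omit [Fintype ι] in
/-- Dropping the least element: the increasing enumeration of `T ∖ {min T}` is the old one shifted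
by one. [folklore] -/
theorem orderEmbOfFin_comp_succ (T : Finset ι) {n : ℕ} (hT : T.card = n + 1)
    (h' : (T.erase (T.orderEmbOfFin hT 0)).card = n) :
    ((T.erase (T.orderEmbOfFin hT 0)).orderEmbOfFin h' : Fin n → ι) =
      (T.orderEmbOfFin hT) ∘ Fin.succ := by
  symm
  apply orderEmbOfFin_unique
  · intro x
    rw [Function.comp_apply, mem_erase]
    exact ⟨fun h => Fin.succ_ne_zero x ((T.orderEmbOfFin hT).injective h), orderEmbOfFin_mem _ _ _⟩
  · exact (T.orderEmbOfFin hT).strictMono.comp (Fin.strictMono_succ)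

omit [Fintype ι] in
/-- Dropping the `i`-th element: the increasing enumeration of `S ∖ {sᵢ}` is the old one composed
with `Fin.succAbove i`. [folklore] -/
theorem orderEmbOfFin_comp_succAbove (S : Finset ι) {n : ℕ} (hS : S.card = n + 1)
    (i : Fin (n + 1)) (h' : (S.erase (S.orderEmbOfFin hS i)).card = n) :
    ((S.erase (S.orderEmbOfFin hS i)).orderEmbOfFin h' : Fin n → ι) =
      (S.orderEmbOfFin hS) ∘ i.succAbove := by
  symm
  apply orderEmbOfFin_unique
  · intro x
    rw [Function.comp_apply, mem_erase]
    exact ⟨fun h => Fin.succAbove_ne i x ((S.orderEmbOfFin hS).injective h),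
      orderEmbOfFin_mem _ _ _⟩
  · exact (S.orderEmbOfFin hS).strictMono.comp (Fin.strictMono_succAbove i)

/-! ### Laplace expansion along the first column, Jordan–Wigner form -/

omit [Fintype ι] in
/-- **Laplace expansion of the minors of `Γ(g)` along the first column**: for `|S| = |T| ≥ 1` and
`t₀ = min T`, `⟨S|Γ(g)|T⟩ = Σ_{x ∈ S} σ_x(S) · g_{x t₀} · ⟨S∖x|Γ(g)|T∖t₀⟩` with the Jordan–Wigner
sign `σ_x(S) = (-1)^{#{s ∈ S | s < x}}`. [folklore] -/
theorem Gamma_apply_eq_sum_erase (g : Matrix ι ι ℂ) {S T : Finset ι} (hT : T.Nonempty)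
    (hST : S.card = T.card) :
    Gamma g S T = ∑ x ∈ S, jwSign x S * g x (T.min' hT) *
      Gamma g (S.erase x) (T.erase (T.min' hT)) := by
  obtain ⟨n, hTn⟩ : ∃ n, T.card = n + 1 := ⟨T.card - 1, by have := hT.card_pos; omega⟩
  have hSn : S.card = n + 1 := hST.trans hTn
  have h0 : T.orderEmbOfFin hTn 0 = T.min' hT := orderEmbOfFin_zero hTn (Nat.succ_pos n)
  rw [Gamma_apply_of_card_eq g hSn hTn, det_succ_column_zero]
  -- re-index the Laplace sum by the elements of `S`
  rw [← Finset.sum_coe_sort S]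
  refine Fintype.sum_equiv (S.orderIsoOfFin hSn).toEquiv _ _ fun i => ?_
  show _ = jwSign (S.orderEmbOfFin hSn i) S * g (S.orderEmbOfFin hSn i) (T.min' hT) *
    Gamma g (S.erase (S.orderEmbOfFin hSn i)) (T.erase (T.min' hT))
  have hxS : S.orderEmbOfFin hSn i ∈ S := orderEmbOfFin_mem _ _ _
  have hcS : (S.erase (S.orderEmbOfFin hSn i)).card = n := by rw [card_erase_of_mem hxS, hSn]; rfl
  have hcT : (T.erase (T.orderEmbOfFin hTn 0)).card = n := by
    rw [card_erase_of_mem (orderEmbOfFin_mem _ _ _), hTn]; rfl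
  -- the three factors
  have hsign : ((-1 : ℂ) ^ (i : ℕ)) = jwSign (S.orderEmbOfFin hSn i) S := by
    rw [jwSign, card_filter_lt_orderEmbOfFin]
  have hentry : (g.submatrix (S.orderEmbOfFin hSn) (T.orderEmbOfFin hTn)) i 0 =
      g (S.orderEmbOfFin hSn i) (T.min' hT) := by
    rw [submatrix_apply, h0]
  have hminor : ((g.submatrix (S.orderEmbOfFin hSn) (T.orderEmbOfFin hTn)).submatrix
      i.succAbove Fin.succ).det = Gamma g (S.erase (S.orderEmbOfFin hSn i)) (T.erase (T.min' hT)) := by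
    rw [submatrix_submatrix, ← orderEmbOfFin_comp_succAbove S hSn i hcS,
      ← orderEmbOfFin_comp_succ T hTn hcT, ← Gamma_apply_of_card_eq g hcS hcT, h0]
  rw [hsign, hentry, hminor]

/-! ### Columns of `Γ(g)` are Slater states: the creation-operator recursion -/

/-- **`Γ(g)|T⟩ = c†(g e_{t₀}) Γ(g)|T ∖ t₀⟩`** for `t₀ = min T`, with the smeared creation operator
`c†(f) = Σᵢ fᵢ c†ᵢ` (`RayleighBound.create`): the Laplace expansion read as the action of a creation
operator. Iterating, `Γ(g)|t₁ < ⋯ < t_k⟩ = c†(g e_{t₁}) ⋯ c†(g e_{t_k}) |∅⟩` is the Slater state of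
the columns `g e_{t₁}, …, g e_{t_k}`. Bratteli–Robinson II §5.2.1. [folklore] -/
theorem col_Gamma_eq_create_mulVec (g : Matrix ι ι ℂ) {T : Finset ι} (hT : T.Nonempty) :
    (Gamma g).col T =
      create (fun i => g i (T.min' hT)) *ᵥ (Gamma g).col (T.erase (T.min' hT)) := by
  funext S
  rw [col_apply, create_mulVec_apply]
  simp only [col_apply, mul_ite, mul_zero]
  rw [Finset.sum_ite_mem, univ_inter]
  by_cases hST : S.card = T.card
  · rw [Gamma_apply_eq_sum_erase g hT hST]
    refine Finset.sum_congr rfl fun x _ => ?_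
    ring
  · rw [Gamma_apply_of_card_ne g hST]
    symm
    refine Finset.sum_eq_zero fun x hx => ?_
    rw [Gamma_apply_of_card_ne g, mul_zero, mul_zero]
    rw [card_erase_of_mem hx, card_erase_of_mem (min'_mem T hT)]
    have h1 := card_pos.mpr ⟨x, hx⟩
    have h2 := hT.card_pos
    omega

/-- `c†(f)² = 0` (Pauli principle for a smeared creation operator). [folklore] -/
theorem create_mul_create_self (f : ι → ℂ) : create f * create f = 0 := by
  have h := create_mul_create f f
  have h2 : (2 : ℂ) • (create f * create f) = 0 := by
    rw [two_smul]
    nth_rw 2 [h]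
    exact add_neg_cancel _
  exact (smul_eq_zero.mp h2).resolve_left two_ne_zero

omit [Fintype ι] in
/-- If no element of `T` lies below `j`, the Jordan–Wigner sign `σ_j(T)` is `1`. [folklore] -/
theorem jwSign_eq_one_of_forall_le {j : ι} {T : Finset ι} (h : ∀ t ∈ T, j ≤ t) : jwSign j T = 1 := by
  rw [jwSign, filter_eq_empty_iff.mpr (fun t ht hlt => (hlt.trans_le (h t ht)).false), card_empty,
    pow_zero]

/-- The creation recursion in both directions (induction on `|T|`): for `j ∉ T`,
`Γ(g)|T ∪ j⟩ = σ_j(T) c†(g e_j) Γ(g)|T⟩`, and for `j ∈ T`, `c†(g e_j) Γ(g)|T⟩ = 0`. [folklore] -/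
theorem col_Gamma_insert_and_create_mulVec_col (g : Matrix ι ι ℂ) (n : ℕ) :
    ∀ T : Finset ι, T.card = n →
      (∀ j, j ∉ T → (Gamma g).col (insert j T) =
          jwSign j T • (create (fun i => g i j) *ᵥ (Gamma g).col T)) ∧
      (∀ j, j ∈ T → create (fun i => g i j) *ᵥ (Gamma g).col T = 0) := by
  induction n with
  | zero =>
    intro T hT
    rw [card_eq_zero] at hT
    subst hT
    refine ⟨fun j _ => ?_, fun j hj => absurd hj (notMem_empty j)⟩
    have h := col_Gamma_eq_create_mulVec g (T := {j}) (singleton_nonempty j)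
    rw [min'_singleton, erase_singleton] at h
    rw [Finset.insert_empty, h, jwSign_eq_one_of_forall_le (fun t ht => absurd ht (notMem_empty t)),
      one_smul]
  | succ n ih =>
    intro T hT
    have hne : T.Nonempty := card_pos.mp (by omega)
    have ht₀ : T.min' hne ∈ T := min'_mem _ _
    have hcard : (T.erase (T.min' hne)).card = n := by rw [card_erase_of_mem ht₀, hT]; rfl
    obtain ⟨ihA, ihB⟩ := ih (T.erase (T.min' hne)) hcard
    have hrec := col_Gamma_eq_create_mulVec g hne
    refine ⟨fun j hj => ?_, fun j hj => ?_⟩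
    · -- j ∉ T
      have hjt : j ≠ T.min' hne := fun h => hj (h ▸ ht₀)
      have h1 := col_Gamma_eq_create_mulVec g (T := insert j T) (insert_nonempty j T)
      rcases lt_or_gt_of_ne hjt with hlt | hgt
      · -- `j` becomes the new minimum
        have hmin : (insert j T).min' (insert_nonempty j T) = j := by
          rw [min'_insert j T hne, min_eq_left hlt.le]
        rw [hmin, erase_insert hj] at h1
        rw [h1, jwSign_eq_one_of_forall_le, one_smul]
        exact fun t ht => (hlt.trans_le (min'_le T t ht)).le
      · -- the minimum stays `t₀ < j`
        have hmin : (insert j T).min' (insert_nonempty j T) = T.min' hne := by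
          rw [min'_insert j T hne, min_eq_right hgt.le]
        rw [hmin, erase_insert_of_ne hjt] at h1
        rw [h1, ihA j (fun h => hj (mem_of_mem_erase h)), mulVec_smul, mulVec_mulVec,
          create_mul_create, neg_mulVec, ← mulVec_mulVec, ← hrec, smul_neg, ← neg_smul,
          jwSign_erase_of_lt ht₀ hgt, neg_neg]
    · -- j ∈ T
      rw [hrec, mulVec_mulVec]
      by_cases hjt : j = T.min' hne
      · rw [hjt, create_mul_create_self, zero_mulVec]
      · rw [create_mul_create, neg_mulVec, ← mulVec_mulVec,
          ihB j (mem_erase.mpr ⟨hjt, hj⟩), mulVec_zero, neg_zero]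

/-- **The intertwining relation `Γ(g) c†_j = c†(g e_j) Γ(g)`** (`c†(g e_j) = Σᵢ g_{ij} c†ᵢ`).
Bratteli–Robinson II §5.2.1 (`Γ(U) a*(f) Γ(U)* = a*(Uf)`), here for arbitrary `g`.
[cite: BratteliRobinsonII1997, §5.2.1] -/
theorem Gamma_mul_creation (g : Matrix ι ι ℂ) (j : ι) :
    Gamma g * creation j = create (fun i => g i j) * Gamma g := by
  apply ext_of_mulVec_single
  intro T
  rw [← mulVec_mulVec, ← mulVec_mulVec, FermionOperatorsProofs.creation_mulVec_single,
    mulVec_single_one]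
  obtain ⟨hA, hB⟩ := col_Gamma_insert_and_create_mulVec_col g T.card T rfl
  by_cases hj : j ∈ T
  · rw [if_pos hj, mulVec_zero, hB j hj]
  · rw [if_neg hj, mulVec_smul, mulVec_single_one, hA j hj, smul_smul, jwSign_mul_self, one_smul]

/-- The intertwining relation for smeared creation operators: `Γ(g) c†(f) = c†(g f) Γ(g)`.
Bratteli–Robinson II §5.2.1. [cite: BratteliRobinsonII1997, §5.2.1] -/
theorem Gamma_mul_create (g : Matrix ι ι ℂ) (f : ι → ℂ) :
    Gamma g * create f = create (g *ᵥ f) * Gamma g := by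
  have hcf : create (g *ᵥ f) = ∑ j, f j • create (fun i => g i j) := by
    simp only [create, mulVec, dotProduct, Finset.smul_sum, smul_smul, Finset.sum_smul]
    rw [Finset.sum_comm]
    refine Finset.sum_congr rfl fun i _ => Finset.sum_congr rfl fun j _ => ?_
    rw [mul_comm]
  rw [hcf, create, Finset.mul_sum, Finset.sum_mul]
  refine Finset.sum_congr rfl fun j _ => ?_
  rw [Matrix.mul_smul, Matrix.smul_mul, Gamma_mul_creation]

/-! ### Functoriality (via the cyclicity of the vacuum) -/

/-- **`Γ(1) = 1`**. Dereziński–Gérard Prop. 3.23 (1). [cite: DerezinskiGerard2022, Prop. 3.23] -/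
theorem Gamma_one : Gamma (1 : Matrix ι ι ℂ) = 1 := by
  refine eq_one_of_commute_creation_of_mulVec_vacuum _ (fun j => ?_) (Gamma_mulVec_vacuum 1)
  rw [Gamma_mul_creation]
  congr 1
  simp [create, Matrix.one_apply]

/-- **Functoriality `Γ(gh) = Γ(g)Γ(h)`** for arbitrary one-body matrices (the Cauchy–Binet
formula for all minors at once, obtained here from the creation recursion).
Dereziński–Gérard Prop. 3.23 (1). [cite: DerezinskiGerard2022, Prop. 3.23] -/
theorem Gamma_mul (g h : Matrix ι ι ℂ) : Gamma (g * h) = Gamma g * Gamma h := by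
  apply ext_of_mulVec_single
  suffices H : ∀ n (T : Finset ι), T.card = n →
      (Gamma (g * h)).col T = Gamma g *ᵥ (Gamma h).col T by
    intro T
    rw [← mulVec_mulVec, mulVec_single_one, mulVec_single_one, H T.card T rfl]
  intro n
  induction n with
  | zero =>
    intro T hT
    rw [card_eq_zero] at hT
    subst hT
    rw [col_Gamma_empty, col_Gamma_empty, Gamma_mulVec_vacuum]
  | succ n ih =>
    intro T hT
    have hne : T.Nonempty := card_pos.mp (by omega)
    have hcard : (T.erase (T.min' hne)).card = n := by rw [card_erase_of_mem (min'_mem _ _), hT]; rfl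
    rw [col_Gamma_eq_create_mulVec (g * h) hne, col_Gamma_eq_create_mulVec h hne, mulVec_mulVec,
      Gamma_mul_create, ← mulVec_mulVec, ← ih (T.erase (T.min' hne)) hcard]
    rfl

/-! ### Adjoint, unitarity, inverses -/

omit [Fintype ι] in
/-- `Γ(gᴴ) = Γ(g)ᴴ` (minors of the conjugate transpose). Dereziński–Gérard §3.3.3.
[folklore] -/
theorem Gamma_conjTranspose (g : Matrix ι ι ℂ) : Gamma gᴴ = (Gamma g)ᴴ := by
  ext S T
  rw [conjTranspose_apply]
  by_cases h : S.card = T.card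
  · rw [Gamma_apply_of_card_eq gᴴ h rfl, Gamma_apply_of_card_eq g rfl h, ← det_conjTranspose,
      conjTranspose_submatrix]
  · rw [Gamma_apply_of_card_ne gᴴ h, Gamma_apply_of_card_ne g (Ne.symm h), star_zero]

/-- `Γ` of a unitary is unitary: `Γ(U)ᴴ Γ(U) = Γ(UᴴU) = Γ(1) = 1`. Bratteli–Robinson II §5.2.1
(`Γ(U)` unitary). [cite: BratteliRobinsonII1997, §5.2.1] -/
theorem Gamma_mem_unitaryGroup {U : Matrix ι ι ℂ} (hU : U ∈ Matrix.unitaryGroup ι ℂ) :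
    Gamma U ∈ Matrix.unitaryGroup (Finset ι) ℂ := by
  rw [Matrix.mem_unitaryGroup_iff'] at hU ⊢
  rw [star_eq_conjTranspose, ← Gamma_conjTranspose, ← Gamma_mul, ← star_eq_conjTranspose, hU,
    Gamma_one]

/-- `Γ(g⁻¹) Γ(g) = 1` for invertible `g`. Dereziński–Gérard Prop. 3.23 (1). [folklore] -/
theorem Gamma_inv_mul {g : Matrix ι ι ℂ} (hg : IsUnit g.det) : Gamma g⁻¹ * Gamma g = 1 := by
  rw [← Gamma_mul, nonsing_inv_mul _ hg, Gamma_one]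

/-- `Γ(g) Γ(g⁻¹) = 1` for invertible `g`. Dereziński–Gérard Prop. 3.23 (1). [folklore] -/
theorem Gamma_mul_inv {g : Matrix ι ι ℂ} (hg : IsUnit g.det) : Gamma g * Gamma g⁻¹ = 1 := by
  rw [← Gamma_mul, mul_nonsing_inv _ hg, Gamma_one]

end Literature.MathematicalPhysics.QuantumLattice
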